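import Mathlib
import Summits.PneNP.PneNP.Theorems.CnfIdealGenLengthRankDefectRepresentationsHalvesBudget

/-!
# Crux `RankDefectRepresentations` (stmt-PneNP-18923), line `rank-dehn-ladder`: AVERAGE ADDITIVITY OVER ZERO-CROSS HALVES —
# the sum of all double cuts of `D` is `2 ^ (2 ^ n')` times the sum of the double cuts of its two halves (lead g16 RESHAPE 14, tool
# stub W16 `stub_avgAdditive`; memo `Cruxes/RankDefectRepresentations/Lines/rank-dehn-ladder-g16.md` §2(i), briefs `…-briefs-g16b.md` §W16)

MERGE setting: the second family has `n' + 1` coordinates and the data `D` has ZERO CROSS DATA at the last one.  By the pointwise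
halves budget additivity `…HalvesBudget.stub_halvesBudget` (W1, p708144), for every `(B, B′)` the double cut `Φ_D(B, B′)` is
`Φ_{H₀}(B, B′ ∩ {σ_last = false}) + Φ_{H₁}(B, B′ ∩ {σ_last = true})`, `H_b` the matrix of cells whose row AND column last bits are `b`.
Summing over all `B′ ⊆ (Fin (n' + 1) → Bool)`: the map `B′ ↦ B′ ∩ {σ_last = b}` onto the power set of `{σ_last = b}` has fibres
`{S ∪ T : T ⊆ {σ_last ≠ b}}` of size `2 ^ #{σ_last ≠ b} = 2 ^ (2 ^ n')` (`sum_filter_eq_pow_mul_sum`, via the splitting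
`B′ = (B′ ∩ {p}) ∪ (B′ ∩ {¬p})`, `sum_eq_sum_powerset_union`; `card_filter_last_eq`), which gives the registered identity
`Σ_{B,B′} Φ_D(B,B′) = 2 ^ (2 ^ n') · (Σ_B Σ_{S ⊆ {last = false}} Φ_{H₀}(B,S) + Σ_B Σ_{S ⊆ {last = true}} Φ_{H₁}(B,S))`
(`stub_avgAdditive`, signature verbatim): in the average currency, MERGE of zero-cross halves is free.
HONEST FRAMING: elementary finite combinatorics; a tool for the MERGE step of the line; `stub_merge` and the crux stay open; P ≠ NP is
not moved; F-N2 is a FRONTIER formal rung.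
-/

set_option linter.dupNamespace false -- `Summit.PneNP.PneNP.…`: summit = sub-problem name (D-0017)

namespace Summit.PneNP.PneNP.Theorems.CnfIdealGenLengthRankDefectRepresentationsAvgAdditive

open Matrix Finset
open Summit.PneNP.PneNP.Theorems.CnfIdealGenLengthRankDefectRepresentationsTwoFamilyCutDomination (doubleCut)
open Summit.PneNP.PneNP.Theorems.CnfIdealGenLengthRankDefectRepresentationsHalvesBudget (stub_halvesBudget)

section Fibres

variable {α : Type} [DecidableEq α] [Fintype α] (p : α → Prop) [DecidablePred p]

/-- **Splitting subsets along a predicate.**  Summing `g` over all subsets `B′` of a finite type is summing `g (S ∪ T)` over the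
pairs `S ⊆ {p}`, `T ⊆ {¬p}` (the bijection `B′ ↦ (B′.filter p, B′.filter ¬p)`, inverse `(S, T) ↦ S ∪ T`). -/
theorem sum_eq_sum_powerset_union {M : Type} [AddCommMonoid M] (g : Finset α → M) :
    ∑ B' : Finset α, g B' =
      ∑ S ∈ (univ.filter p).powerset, ∑ T ∈ (univ.filter fun a => ¬ p a).powerset, g (S ∪ T) := by
  rw [← Finset.sum_product']
  refine Finset.sum_nbij' (fun B' => (B'.filter p, B'.filter fun a => ¬ p a)) (fun x => x.1 ∪ x.2) ?_ ?_ ?_ ?_ ?_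
  · intro B' _
    simp only [Finset.mem_product, Finset.mem_powerset]
    exact ⟨filter_subset_filter p (subset_univ B'), filter_subset_filter _ (subset_univ B')⟩
  · intro x _
    exact mem_univ _
  · intro B' _
    exact filter_union_filter_not_eq p B'
  · intro x hx
    simp only [Finset.mem_product, Finset.mem_powerset] at hx
    have h1 : ∀ a ∈ x.1, p a := fun a ha => (mem_filter.mp (hx.1 ha)).2
    have h2 : ∀ a ∈ x.2, ¬ p a := fun a ha => (mem_filter.mp (hx.2 ha)).2
    have h1' : ∀ a ∈ x.1, ¬ ¬ p a := fun a ha => not_not_intro (h1 a ha)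
    refine Prod.ext ?_ ?_
    · simp only [filter_union, filter_true_of_mem h1, filter_false_of_mem h2, union_empty]
    · simp only [filter_union, filter_false_of_mem h1', filter_true_of_mem h2, empty_union]
  · intro B' _
    simp only [filter_union_filter_not_eq]

/-- **Fibre count.**  `Σ_{B′} f (B′.filter p) = 2 ^ #{¬p} · Σ_{S ⊆ {p}} f S`: every `S ⊆ {p}` is hit by exactly the `2 ^ #{¬p}` subsets
`S ∪ T`, `T ⊆ {¬p}`. -/
theorem sum_filter_eq_pow_mul_sum (f : Finset α → ℕ) :
    ∑ B' : Finset α, f (B'.filter p) =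
      2 ^ (univ.filter fun a => ¬ p a).card * ∑ S ∈ (univ.filter p).powerset, f S := by
  rw [sum_eq_sum_powerset_union p (fun B' => f (B'.filter p)), Finset.mul_sum]
  refine Finset.sum_congr rfl fun S hS => ?_
  have hS' : ∀ a ∈ S, p a := fun a ha => (mem_filter.mp (mem_powerset.mp hS ha)).2
  have hsum : ∑ T ∈ (univ.filter fun a => ¬ p a).powerset, f ((S ∪ T).filter p) =
      ∑ T ∈ (univ.filter fun a => ¬ p a).powerset, f S := by
    refine Finset.sum_congr rfl fun T hT => ?_
    have hT' : ∀ a ∈ T, ¬ p a := fun a ha => (mem_filter.mp (mem_powerset.mp hT ha)).2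
    rw [filter_union, filter_true_of_mem hS', filter_false_of_mem hT', union_empty]
  rw [hsum, Finset.sum_const, Finset.card_powerset, smul_eq_mul]

end Fibres

section LastBit

/-- **Half of the colour cube.**  The colours `σ : Fin (n' + 1) → Bool` with prescribed last bit `c` are `2 ^ n'` in number
(`σ ↦ Fin.init σ` is a bijection onto `Fin n' → Bool`, inverse `τ ↦ Fin.snoc τ c`). -/
theorem card_filter_last_eq (n' : ℕ) (c : Bool) :
    (univ.filter fun σ : Fin (n' + 1) → Bool => σ (Fin.last n') = c).card = 2 ^ n' := by
  have h : (univ.filter fun σ : Fin (n' + 1) → Bool => σ (Fin.last n') = c).card =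
      (univ : Finset (Fin n' → Bool)).card := by
    refine Finset.card_nbij' (fun σ => Fin.init σ) (fun τ => Fin.snoc τ c) ?_ ?_ ?_ ?_
    · intro σ _
      exact mem_univ _
    · intro τ _
      exact mem_filter.mpr ⟨mem_univ _, Fin.snoc_last _ _⟩
    · intro σ hσ
      have hlast : σ (Fin.last n') = c := (mem_filter.mp hσ).2
      rw [← hlast]
      exact Fin.snoc_init_self σ
    · intro τ _
      exact Fin.init_snoc _ _
  rw [h, Finset.card_univ, Fintype.card_fun, Fintype.card_bool, Fintype.card_fin]

/-- The complementary half `{σ_last ≠ b}` also has `2 ^ n'` colours (it is the half `{σ_last = !b}`). -/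
theorem card_filter_last_ne (n' : ℕ) (b : Bool) :
    (univ.filter fun σ : Fin (n' + 1) → Bool => ¬ σ (Fin.last n') = b).card = 2 ^ n' := by
  have h : (univ.filter fun σ : Fin (n' + 1) → Bool => ¬ σ (Fin.last n') = b) =
      univ.filter fun σ : Fin (n' + 1) → Bool => σ (Fin.last n') = !b := by
    refine Finset.filter_congr fun σ _ => ?_
    cases σ (Fin.last n') <;> cases b <;> decide
  rw [h, card_filter_last_eq]

end LastBit

section Halves

variable {K : Type} [Field K] {n n' : ℕ} {ι ι' : Type} [Fintype ι] [Fintype ι'] [DecidableEq ι] [DecidableEq ι']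
variable (row : ι → Fin n ⊕ Fin (n' + 1) → Bool) (col : ι' → Fin n ⊕ Fin (n' + 1) → Bool)

omit [Fintype ι] [DecidableEq ι] [DecidableEq ι'] in
/-- **One half, summed.**  For any matrix `M` and last bit `b`: summing `Φ_M(B, B′ ∩ {σ_last = b})` over ALL `(B, B′)` is
`2 ^ (2 ^ n')` times the sum of `Φ_M(B, S)` over `B` and `S ⊆ {σ_last = b}` (fibre count, both halves of the cube having `2 ^ n'` colours). -/
theorem sum_sum_doubleCut_filter_last (b : Bool) (M : Matrix ι ι' K) :
    ∑ B : Finset (Fin n → Bool), ∑ B' : Finset (Fin (n' + 1) → Bool),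
        doubleCut row col B (B'.filter fun σ => σ (Fin.last n') = b) M =
      2 ^ (2 ^ n') * ∑ B : Finset (Fin n → Bool),
        ∑ S ∈ (univ.filter fun σ : Fin (n' + 1) → Bool => σ (Fin.last n') = b).powerset, doubleCut row col B S M := by
  rw [Finset.mul_sum]
  refine Finset.sum_congr rfl fun B _ => ?_
  rw [sum_filter_eq_pow_mul_sum (fun σ : Fin (n' + 1) → Bool => σ (Fin.last n') = b) (fun S => doubleCut row col B S M),
    card_filter_last_ne]

end Halves

/-- **AVERAGE ADDITIVITY OVER ZERO-CROSS HALVES** (registered tool stub W16 `stub_avgAdditive` of the skeleton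
`Lines/rank_dehn_ladder.lean`, signature verbatim).  In the MERGE setting (`n' + 1` second-family coordinates, ZERO cross data at the
last coordinate) the sum of ALL double cuts `Φ_D(B, B′)` equals `2 ^ (2 ^ n')` times the sum, over `B` and over the subsets `S` of each
half `{σ_last = b}` of the second-family colour cube, of the double cuts of the half matrix `H_b` (cells with row AND column last bits
`b`): pointwise splitting `stub_halvesBudget` (W1), then the fibre count `sum_sum_doubleCut_filter_last` on each half.  Division-free
form of `ē(N₀ ⊞ N₁) = ē(N₀) + ē(N₁)`. -/
theorem stub_avgAdditive :
    ∀ (K : Type) [Field K] (n n' : ℕ) (ι ι' : Type) [Fintype ι] [Fintype ι'] [DecidableEq ι] [DecidableEq ι']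
      (row : ι → Fin n ⊕ Fin (n' + 1) → Bool) (col : ι' → Fin n ⊕ Fin (n' + 1) → Bool) (D : Matrix ι ι' K),
      (∀ x y, row x (Sum.inr (Fin.last n')) ≠ col y (Sum.inr (Fin.last n')) → D x y = 0) →
      ∑ B : Finset (Fin n → Bool), ∑ B' : Finset (Fin (n' + 1) → Bool),
          Summit.PneNP.PneNP.Theorems.CnfIdealGenLengthRankDefectRepresentationsTwoFamilyCutDomination.doubleCut row col B B' D =
        2 ^ (2 ^ n') *
          (∑ B : Finset (Fin n → Bool),
              ∑ S ∈ (Finset.univ.filter fun σ : Fin (n' + 1) → Bool => σ (Fin.last n') = false).powerset,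
                Summit.PneNP.PneNP.Theorems.CnfIdealGenLengthRankDefectRepresentationsTwoFamilyCutDomination.doubleCut row col B S
                  (Matrix.of fun x y =>
                    if row x (Sum.inr (Fin.last n')) = false ∧ col y (Sum.inr (Fin.last n')) = false then D x y else 0) +
            ∑ B : Finset (Fin n → Bool),
              ∑ S ∈ (Finset.univ.filter fun σ : Fin (n' + 1) → Bool => σ (Fin.last n') = true).powerset,
                Summit.PneNP.PneNP.Theorems.CnfIdealGenLengthRankDefectRepresentationsTwoFamilyCutDomination.doubleCut row col B S
                  (Matrix.of fun x y =>
                    if row x (Sum.inr (Fin.last n')) = true ∧ col y (Sum.inr (Fin.last n')) = true then D x y else 0)) := by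
  intro K _ n n' ι ι' _ _ _ _ row col D hcross
  have hsplit := stub_halvesBudget K n n' ι ι' row col D hcross
  simp_rw [hsplit]
  simp only [Finset.sum_add_distrib]
  rw [sum_sum_doubleCut_filter_last row col false, sum_sum_doubleCut_filter_last row col true, mul_add]

end Summit.PneNP.PneNP.Theorems.CnfIdealGenLengthRankDefectRepresentationsAvgAdditive
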